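import Mathlib
import HarnessLib
import Literature.Computability.AlgebraicComplexity.PatternExpressions
import Summits.ValiantsHypothesis.ValiantsHypothesis.Theorems.MonotoneRestorationOrbitCompressionQPNarrowClosureSums
import Summits.ValiantsHypothesis.ValiantsHypothesis.Theorems.MonotoneRestorationOrbitCompressionQPNarrowMatrixProduct

/-!
# Route MonotoneRestoration — aside `OrbitCompressionQP` (stmt-ValiantsHypothesis-18332), line
# `expression_compression`: the SYMMETRIC-ABP CRITERION for «narrow of quasi-polynomial length»

Packaging of `NarrowClosure.exists_matrixProd` at the family level: if `f_n` is, at every label assignment,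
one entry of the product of quasi-polynomially many matrices of quasi-polynomial dimension whose entries are
`(1,1)`-label pattern expressions of quasi-polynomial length — an «algebraic branching program over closed
narrow expressions», e.g. over the power sums of the row sums, of the column sums, of the entries — then `f`
satisfies the conclusion of `stub_narrowExpressionCompression` (one row and one column label).

* `matrixProduct_length_qp` — the arithmetic `(2D+2)^{log₂ N + 1} (Q + D + 1) + 2 ≤ 2^{polylog}`;
* `narrowQP_of_matrixProduct` — the criterion.

This is the engine behind `Theorems/…NarrowEsymmRowSums.lean` (Newton's recurrence as such a product) and the
tree-side glue of the «one-row stratum» of the stub (what remains there is in print: the symmetric-reduction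
theorem of Bläser–Jindal, ITCS 2019, Thm 4, and circuit-to-ABP balancing).  Helper file
(`--supports stmt-ValiantsHypothesis-18332`); def-free; nothing here is a named fact; VP ≠ VNP is not moved.
-/

noncomputable section

open MvPolynomial

-- `Summit.ValiantsHypothesis.ValiantsHypothesis.…` is the tree's single-conjunct layout (Sub = Summit).
set_option linter.dupNamespace false

namespace Summit.ValiantsHypothesis.ValiantsHypothesis.Theorems

namespace NarrowClosure

open Literature.Computability.AlgebraicComplexity

/-- Length bookkeeping for balanced matrix products: with `D, N, Q ≤ 2^{(log₂ n + a)^a}`,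
`(2D+2)^{log₂ N + 1} (Q + D + 1) + 2 ≤ 2^{(log₂ n + c')^{c'}}`. [folklore] -/
theorem matrixProduct_length_qp (a : ℕ) : ∃ c' : ℕ, ∀ L D N Q : ℕ, D ≤ 2 ^ ((L + a) ^ a) →
    N ≤ 2 ^ ((L + a) ^ a) → Q ≤ 2 ^ ((L + a) ^ a) →
    (2 * D + 2) ^ (Nat.log 2 N + 1) * (Q + D + 1) + 2 ≤ 2 ^ ((L + c') ^ c') := by
  obtain ⟨c', hc'⟩ := CompressionFloors.polylog_master a 3
  refine ⟨c', fun L D N Q hD hN hQ => ?_⟩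
  set M := (L + a) ^ a with hM
  set β := (L + a) ^ a + L + 2 with hβ
  have h2M : 1 ≤ 2 ^ M := Nat.one_le_two_pow
  have hM1 : 1 ≤ M := by
    rcases Nat.eq_zero_or_pos a with h0 | h0
    · simp [hM, h0]
    · exact Nat.one_le_pow _ _ (by omega)
  have hlog : Nat.log 2 N ≤ M :=
    (Nat.log_mono_right hN).trans (by rw [Nat.log_pow (by norm_num)])
  have h22 : 2 * D + 2 ≤ 2 ^ (M + 2) := by
    have : 2 ^ (M + 2) = 2 ^ M * 4 := by rw [pow_add]; norm_num
    omega
  have hQD : Q + D + 1 ≤ 2 ^ (M + 2) := by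
    have : 2 ^ (M + 2) = 2 ^ M * 4 := by rw [pow_add]; norm_num
    omega
  have hA : (2 * D + 2) ^ (Nat.log 2 N + 1) ≤ 2 ^ ((M + 2) * (M + 1)) := by
    calc (2 * D + 2) ^ (Nat.log 2 N + 1) ≤ (2 ^ (M + 2)) ^ (Nat.log 2 N + 1) := Nat.pow_le_pow_left h22 _
      _ ≤ (2 ^ (M + 2)) ^ (M + 1) := Nat.pow_le_pow_right (by positivity) (by omega)
      _ = 2 ^ ((M + 2) * (M + 1)) := by rw [← pow_mul]
  have hexp : (M + 2) * (M + 1) + (M + 2) + 1 ≤ β ^ 3 := by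
    have hb : M + 2 ≤ β := by omega
    have hβ3 : 3 ≤ β := by omega
    have e1 : (M + 2) * (M + 1) ≤ β * β := Nat.mul_le_mul (by omega) (by omega)
    have e2 : β * β + β * β ≤ β ^ 3 := by
      calc β * β + β * β = 2 * (β * β) := by ring
        _ ≤ β * (β * β) := Nat.mul_le_mul_right _ (by omega)
        _ = β ^ 3 := by ring
    have e3 : β * β + (M + 2) + 1 ≤ β * β + β * β := by nlinarith
    calc (M + 2) * (M + 1) + (M + 2) + 1 ≤ β * β + (M + 2) + 1 :=
        Nat.add_le_add_right (Nat.add_le_add_right e1 _) _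
      _ ≤ β * β + β * β := e3
      _ ≤ β ^ 3 := e2
  have h1 : 2 ≤ 2 ^ ((M + 2) * (M + 1) + (M + 2)) :=
    le_trans (by norm_num) (Nat.pow_le_pow_right (by norm_num) (le_add_left (by omega) :
      1 ≤ (M + 2) * (M + 1) + (M + 2)))
  calc (2 * D + 2) ^ (Nat.log 2 N + 1) * (Q + D + 1) + 2
      ≤ 2 ^ ((M + 2) * (M + 1)) * 2 ^ (M + 2) + 2 := Nat.add_le_add_right (Nat.mul_le_mul hA hQD) 2
    _ = 2 ^ ((M + 2) * (M + 1) + (M + 2)) + 2 := by rw [← pow_add]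
    _ ≤ 2 ^ ((M + 2) * (M + 1) + (M + 2) + 1) := by
        rw [pow_succ]
        have := h1
        generalize 2 ^ ((M + 2) * (M + 1) + (M + 2)) = Y at this ⊢
        omega
    _ ≤ 2 ^ (β ^ 3) := Nat.pow_le_pow_right (by norm_num) hexp
    _ ≤ 2 ^ ((L + c') ^ c') := Nat.pow_le_pow_right (by norm_num) (hc' L _ le_rfl)

/-- **The symmetric-ABP criterion.**  If, for one constant `c` and every `n ≥ 1`, `f n` is — at every label
assignment — the `(i, j)` entry of the product of a list of `N ≤ 2^{(log₂ n + c)^c}` matrices of dimension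
`D ≤ 2^{(log₂ n + c)^c}` whose entries are `(1,1)`-label pattern expressions of length `≤ 2^{(log₂ n + c)^c}`,
then `f` is narrow of quasi-polynomial length (the conclusion of `stub_narrowExpressionCompression`).
[folklore] -/
theorem narrowQP_of_matrixProduct (f : (n : ℕ) → MvPolynomial (Fin n × Fin n) ℂ)
    (h : ∃ c : ℕ, ∀ n : ℕ, 1 ≤ n → ∃ (D : ℕ) (Lm : List (Matrix (Fin D) (Fin D) (PatternExpr ℂ 1 1)))
      (i j : Fin D),
      D ≤ 2 ^ ((Nat.log 2 n + c) ^ c) ∧ Lm.length ≤ 2 ^ ((Nat.log 2 n + c) ^ c) ∧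
      (∀ M ∈ Lm, ∀ a b, (M a b).length ≤ 2 ^ ((Nat.log 2 n + c) ^ c)) ∧
      (∀ ρ γ : Fin 1 → Fin n,
        ((Lm.map fun M : Matrix (Fin D) (Fin D) (PatternExpr ℂ 1 1) =>
          M.map fun e => e.value n ρ γ).prod) i j = f n)) :
    ∃ c : ℕ, ∀ n : ℕ, 1 ≤ n → ∃ (k l : ℕ) (e : PatternExpr ℂ k l),
      n ^ (k + l) ≤ 2 ^ ((Nat.log 2 n + c) ^ c) ∧ e.length ≤ 2 ^ ((Nat.log 2 n + c) ^ c) ∧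
      e.close n = f n := by
  obtain ⟨a, ha⟩ := h
  obtain ⟨c₁, hc₁⟩ := CompressionFloors.labels_qp 1
  obtain ⟨c₂, hc₂⟩ := matrixProduct_length_qp a
  refine ⟨max c₁ c₂, fun n hn => ?_⟩
  obtain ⟨D, Lm, i, j, hD, hN, hlen, hval⟩ := ha n hn
  have hLlen : Lm.length ≤ 2 ^ (Nat.log 2 Lm.length + 1) := (Nat.lt_pow_succ_log_self Nat.one_lt_two _).le
  obtain ⟨P, hPlen, hPval⟩ := exists_matrixProd (2 ^ ((Nat.log 2 n + a) ^ a)) (Nat.log 2 Lm.length + 1)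
    Lm hLlen hlen
  have hv : ∀ ρ γ : Fin 1 → Fin n, (P i j).value n ρ γ = f n := by
    intro ρ γ
    have h := congrFun (congrFun (hPval n ρ γ) i) j
    rw [Matrix.map_apply] at h
    rw [h, hval ρ γ]
  have hn0 : ((n * n : ℕ) : ℂ) ≠ 0 := by
    have : 0 < n := hn
    exact Nat.cast_ne_zero.2 (by positivity)
  refine ⟨1, 1, PatternExpr.mul (PatternExpr.const (((n * n : ℕ) : ℂ))⁻¹) (P i j), ?_, ?_, ?_⟩
  · exact (hc₁ n 1 (by rw [pow_one]; exact Nat.le_add_left 1 _)).trans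
      (Nat.pow_le_pow_right (by norm_num) (CompressionFloors.polylog_mono (le_max_left _ _)))
  · have hl : (PatternExpr.mul (PatternExpr.const (((n * n : ℕ) : ℂ))⁻¹) (P i j)).length =
        (P i j).length + 2 := by
      simp [PatternExpr.length]; ring
    rw [hl]
    calc (P i j).length + 2
        ≤ (2 * D + 2) ^ (Nat.log 2 Lm.length + 1) * (2 ^ ((Nat.log 2 n + a) ^ a) + D + 1) + 2 :=
          Nat.add_le_add_right (hPlen i j) 2
      _ ≤ 2 ^ ((Nat.log 2 n + c₂) ^ c₂) := hc₂ _ _ _ _ hD hN le_rfl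
      _ ≤ _ := Nat.pow_le_pow_right (by norm_num) (CompressionFloors.polylog_mono (le_max_right _ _))
  · rw [ShortClose.close_const_mul, close_eq_of_value_const _ _ hv, smul_smul, inv_mul_cancel₀ hn0, one_smul]

end NarrowClosure

end Summit.ValiantsHypothesis.ValiantsHypothesis.Theorems

end
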